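import Summits.HubbardSuperconductivity.HubbardLadder.Bounds.ThermalMottStiffnessCeiling
import Summits.HubbardSuperconductivity.HubbardLadder.Bounds.ThermalMottCDWCeilingCanonical
import Literature.MathematicalPhysics.QuantumLattice.HubbardCanonicalSusceptibilityBounds
import HarnessLib


/-!
# Hubbard ladder — Bounds: the CANONICAL spin-susceptibility and staggered-magnetisation (SDW)
# ceilings of the ATTRACTIVE torus at `T > 0`, EVERY density — UNCONDITIONAL
# (bounds.tex Thm 11 (A1)–(A3) in the canonical `(2m, S^z = 0)` ensemble, Cor. 11.2; typed AND proved)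

HONEST FRAMING (cell pub-hubbard): ladder R1–R4 with certified numbers; no claim on H/H₀. These
are bounds for a MODEL CLASS — the attractive Hubbard torus `hubbardTorusTT' L 1 0 U`
(`= hamiltonian (fermionTorusGraph 2 L) 1 U`; `t = 1`, `t' = 0`, `U < 0`, torus `(ℤ/Lℤ)²`) in the
CANONICAL Gibbs state `⟨·⟩_{β,p}` of its compression `H|_p` to the `(2m, S^z = 0)` coordinate sector
`p` (`|s| = 2m`, `2 · #{i ∈ s : spin i = 0} = 2m`, any `m ≤ L²`: density `n = 2m/L²`; the sector and
the state of `ThermalAttractiveKineticCeilingSharp`, #106 in the tree) at `β > 0`; no materials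
claim. Companion text: `pub-hubbard/paper/bounds.tex` Thm 8♯, Thm 9, Thm 11, Cor. 11.2, Remark 11;
tables `pub-hubbard/pub-hubbard-bounds/BOUNDS.md` (rows T6♯, T7, T9, T9ᶜ) and `EXTREMISERS.md` §5t.

Kubo–Kishi's Theorem 1 (spin susceptibility `≤ 1/|U|`, no SDW order at `T > 0`, attractive model)
is stated grand-canonically. Here it is a theorem of the CANONICAL ensemble at every particle number
`2m`, with NOTHING assumed: the sector Gaussian domination is the PROVED tree theorem
`hubbard_attractive_sector_blockGaussianDomination` (Lieb's spin-reflection positivity in the sector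
`(m,m)`), and the Falk–Bruch constant is the exact BLOCK f-sum value `4⟨-T⟩_{β,p}`, bounded by the
cell's attractive kinetic ceilings `32 L²/|U|` (Thm 8♯(v), #106) and `256 m/|U|` (Thm 9(v), #103)
plus one entropy term — instead of the degree bound `16 L²` of KK90 Remark 3.

## What is proved (no `sorry`, no new axioms, no named-fact hypothesis)

For `U < 0`, `β > 0`, `m ≤ L²`, `p` ANY decidable presentation of the `(m ↑, m ↓)` sector,
`M_a = Σ_x a_x (n_{x↑} - n_{x↓})`, `M_Q = M_ε` (`ε` the sublattice sign, `L` even), `H = H(1,U)`: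
* `duhamel_spinDensityField_toBlock_le_attractive` — **(A1) canonically, every `L ≥ 1`, every real
  profile `a`**: `(M_a|_p, M_a|_p)_{β,H|_p} ≤ Σ_x a_x²/(β|U|)` (`χ_zz(q) ≤ 1/|U|` per site, every `q`).
* `re_gibbsState_staggeredSpin_sq_toBlock_le_of_kinetic` — **(A2) + block f-sum**: `⟨-T|_p⟩_{β,p} ≤ k`
  implies `⟨(M_Q|_p)²⟩_{β,p} ≤ L²/(β|U|) + ½ √((L²/|U|) · 4k)`; whence `…_le_attractive_sharp`
  (`k = 32 L²/|U| + (log N_p)/β`, `L ≥ 4` even) and `…_le_attractive_density` (`k = 256 m/|U| +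
  (log N_p)/β`), `N_p = dim p = binom(L²,m)²`, `log N_p ≤ L² log 4`.
* Nodes `ThermalAttractiveSpinSusceptibilityCeilingCanonical`, `ThermalAttractiveSDWCeilingCanonical`,
  `ThermalAttractiveSDWCeilingCanonicalDensity` (`@[conjecture] def`, each proved by `…_holds`) and
  `ThermalAttractiveSDWCeilingCanonicalU20` (`U = -20`): per site `4 S^{zz}(Q)_p := ⟨(M_Q|_p)²⟩_{β,p}/L²
  ≤ T/20 + √((1.6 + T log 4)/20)` (`0.283` at `T → 0` vs `√(4/20) = 0.447` from the degree bound).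

Honest numbers: the SDW ceiling beats the degree form only for `|U| > 8t` or `n < |U|/32`; finite
volume, fixed particle numbers; TL and `T = 0` not addressed; the `t/|U|` power is not claimed sharp.
References (keys of `lean/references.bib`): KuboKishi1990 Thm 1, eqs. (3)–(4), Remarks 1, 3;
LiebPRL1989 Thm 1; DLS1978 Lemma 4.1, Thm 3.1; MicnasRanningerRobaszkiewicz1990 §IV;
HazraVermaRanderia2019 App. G.
FILER'S NOTE (lit g12, LEAN FILING REQUEST #174): the four generic helpers of the staged file
(`hoppingForm_const_on_bonds`, `log_card_coordSector_le`, `hoppingForm_one_eq_neg_kinetic`,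
`falkBruch_rhs_mono`) restated declarations that landed meanwhile in
`Bounds/ThermalMottCDWCeilingCanonical.lean` (#173); per the gate's `dedup.landed` rule they are
deleted here and the landed `hoppingForm_eq_smul_one_of_adj`, `log_card_sector_le_log_four`,
`hoppingForm_one_eq_neg_hubbardTorusTT'`, `fbRhs_mono_doubleComm` are used instead (that module is
now imported). Every other declaration — in particular the four `@[conjecture]` nodes and their
`_holds` — is byte-identical to the staged text (sha256 5f5bdfb5569a2791…).
-/


noncomputable section

namespace Summit.HubbardSuperconductivity.HubbardLadder.Bounds

open Matrix Finset Real
open Literature.MathematicalPhysics.QuantumLattice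
open Literature.MathematicalPhysics.QuantumFieldTheory
open Literature.Probability.LatticeModels
open scoped ComplexOrder ComplexConjugate

/-- A configuration lies in the `(2m, S^z = 0)` coordinate sector iff it has `m` up and `m` down
electrons. -/
theorem spinZeroSector_iff_upPart_downPart {Λ : Type*} [LinearOrder Λ] [Fintype Λ] (s : Finset (Orb Λ))
    (m : ℕ) : (s.card = 2 * m ∧ 2 * (s.filter fun i => (ofLex i).2 = 0).card = 2 * m) ↔
      (upPart s).card = m ∧ (downPart s).card = m := by
  refine ⟨fun h => ?_, fun h => spinZeroSector_of_card_upPart_downPart h⟩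
  have hu : (upPart s).card = m := by
    have h2 := h.2
    rw [card_filter_spin_zero_eq_card_upPart] at h2
    omega
  refine ⟨hu, ?_⟩
  have hc := card_eq_upPart_add_downPart s
  rw [h.1, hu] at hc
  omega

section Torus

variable {L : ℕ} [NeZero L]

/-- The torus graph `(ℤ/Lℤ)²` with nearest-neighbour bonds. -/
local notation "Gᴸ" => fermionTorusGraph 2 L
/-- The staggered magnetisation field `M_Q = Σ_x (-1)^x (n_{x↑} - n_{x↓})`. -/
local notation "M_Q" =>
  spinDensityField fun x => ((torusStagger (d := 2) (L := L) x : ℤ) : ℝ)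

omit [NeZero L] in
/-- `H(1,U)` on the torus at `t' = 0` is the graph Hamiltonian `hamiltonianWith (fermionTorusGraph 2 L) 1 U 0`
(zero chemical potential). -/
theorem hubbardTorusTT'_eq_hamiltonianWith (U : ℝ) :
    hubbardTorusTT' L 1 0 U = hamiltonianWith Gᴸ 1 U 0 := by
  rw [hubbardTorusTT'_zero, hamiltonianWith_zero]; rfl

/-! ### (A1) canonically: the spin susceptibility ceiling, every profile, every density -/

omit [NeZero L] in
/-- **Kubo–Kishi (3) in a `(m ↑, m ↓)` sector of the attractive torus, UNCONDITIONAL** (every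
`L ≥ 1`, `U < 0`, `β > 0`, `p` any presentation of the sector, non-empty, `a` any real profile):
`(M_a|_p, M_a|_p)_{β, H(1,U)|_p} ≤ Σ_x a_x²/(β|U|)` — per site `χ_zz(q) ≤ 1/|U|` for every `q`. -/
theorem duhamel_spinDensityField_toBlock_le_attractive {U β : ℝ} (hU : U < 0) (hβ : 0 < β) {m : ℕ}
    (a : FermionTorus 2 L → ℝ) (p : Finset (Orb (FermionTorus 2 L)) → Prop) [DecidablePred p]
    [Nonempty {s // p s}] (hp : ∀ s, p s ↔ (upPart s).card = m ∧ (downPart s).card = m) :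
    (duhamel β ((hubbardTorusTT' L 1 0 U).toBlock p p) ((spinDensityField a).toBlock p p)
        ((spinDensityField a).toBlock p p)).re ≤ (∑ x, a x ^ 2) / (-U) / β := by
  have h := hubbard_attractive_sector_duhamel_le Gᴸ (t := 1) (μ := 0) hU hβ a p hp
  rw [abs_of_neg hU] at h
  rw [hubbardTorusTT'_eq_hamiltonianWith]
  convert h using 6

/-- Node form of (A1) in the `(2m, S^z = 0)` sector of #106 (`ThermalAttractiveKineticCeilingSharp`):
for every `L ≥ 1`, `U < 0`, `T > 0`, `m ≤ L²` and every real profile `a`,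
`β (M_a|_p, M_a|_p)_{β,p} ≤ Σ_x a_x²/|U|` — the canonical longitudinal spin susceptibility of the
attractive Hubbard torus is `≤ 1/|U|` per site at every wave vector, density and temperature.
kind: support (PROVED, unconditional). Why it might fail: it cannot. Sources: KuboKishi1990 Thm 1,
eq. (3); LiebPRL1989 Thm 1; DLS1978 Lemma 4.1; this cell (bounds.tex Thm 11 (A1), Cor. 11.2(i)). -/
@[conjecture] def ThermalAttractiveSpinSusceptibilityCeilingCanonical : Prop :=
  ∀ (L : ℕ) [NeZero L] (U β : ℝ) (m : ℕ) (a : FermionTorus 2 L → ℝ), U < 0 → 0 < β → m ≤ L ^ 2 →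
    let p : Finset (Orb (FermionTorus 2 L)) → Prop := fun s =>
      s.card = 2 * m ∧ 2 * (s.filter fun i => (ofLex i).2 = 0).card = 2 * m
    β * (duhamel β ((hubbardTorusTT' L 1 0 U).toBlock p p) ((spinDensityField a).toBlock p p)
        ((spinDensityField a).toBlock p p)).re ≤ (∑ x, a x ^ 2) / (-U)

/-- **`ThermalAttractiveSpinSusceptibilityCeilingCanonical` holds.** -/
theorem thermalAttractiveSpinSusceptibilityCeilingCanonical_holds :
    ThermalAttractiveSpinSusceptibilityCeilingCanonical := by
  intro L _ U β m a hU hβ hm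
  dsimp only
  set p : Finset (Orb (FermionTorus 2 L)) → Prop := fun s =>
    s.card = 2 * m ∧ 2 * (s.filter fun i => (ofLex i).2 = 0).card = 2 * m with hp
  haveI : Nonempty {s // p s} := nonempty_spinZeroSector (L := L) hm
  have h := duhamel_spinDensityField_toBlock_le_attractive hU hβ a p
    fun s => spinZeroSector_iff_upPart_downPart s m
  calc β * _ ≤ β * ((∑ x, a x ^ 2) / (-U) / β) := mul_le_mul_of_nonneg_left h hβ.le
    _ = (∑ x, a x ^ 2) / (-U) := by rw [mul_comm]; exact div_mul_cancel₀ _ hβ.ne'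

/-! ### (A2) canonically with the block f-sum constant: the SDW ceilings -/

omit [NeZero L] in
/-- **Falk–Bruch in a `(m ↑, m ↓)` sector with the exact block f-sum constant** (`L` even, `U < 0`,
`β > 0`): if the sector kinetic energy obeys `⟨-T|_p⟩_{β,p} = -Re⟨H(1,0)|_p⟩_{β,p} ≤ k`, then
`⟨(M_Q|_p)²⟩_{β,p} ≤ L²/(β|U|) + ½ √((L²/|U|) · 4k)`. [`[M_Q|_p,[H|_p,M_Q|_p]] = (T((ε_x-ε_y)²))|_p
= 4 T(1)|_p = -4 H(1,0)|_p`.] -/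
theorem re_gibbsState_staggeredSpin_sq_toBlock_le_of_kinetic (hLe : Even L) {U β k : ℝ} (hU : U < 0)
    (hβ : 0 < β) {m : ℕ} (p : Finset (Orb (FermionTorus 2 L)) → Prop) [DecidablePred p]
    [Nonempty {s // p s}] (hp : ∀ s, p s ↔ (upPart s).card = m ∧ (downPart s).card = m)
    (hkin : -(gibbsState β ((hubbardTorusTT' L 1 0 U).toBlock p p)
        ((hubbardTorusTT' L 1 0 0).toBlock p p)).re ≤ k) :
    (gibbsState β ((hubbardTorusTT' L 1 0 U).toBlock p p) ((M_Q).toBlock p p * (M_Q).toBlock p p)).re ≤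
      (L : ℝ) ^ 2 / (-U) / β + 1 / 2 * Real.sqrt ((L : ℝ) ^ 2 / (-U) * (4 * k)) := by
  have hU0 : 0 < -U := neg_pos.2 hU
  have hcard : Fintype.card (FermionTorus 2 L) = L ^ 2 := by simp [FermionTorus]
  have hε : ∀ x y : FermionTorus 2 L, (Gᴸ).Adj x y →
      torusStagger (d := 2) (L := L) x = -torusStagger y :=
    fun _ _ h => torusStagger_eq_neg_of_adj_holds hLe h
  have h := hubbard_attractive_sector_falkBruch_le Gᴸ (t := 1) (μ := 0) hU hβ p hp
    (ι := Unit) (fun _ => fun x => ((torusStagger (d := 2) (L := L) x : ℤ) : ℝ))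
  simp only [Finset.univ_unique, Finset.sum_singleton] at h
  have hsq : ∀ x : FermionTorus 2 L, (((torusStagger (d := 2) (L := L) x : ℤ) : ℝ)) ^ 2 = 1 := by
    intro x
    rcases Int.units_eq_one_or (torusStagger (d := 2) (L := L) x) with h1 | h1 <;> simp [h1]
  have hB : (∑ x : FermionTorus 2 L, (((torusStagger (d := 2) (L := L) x : ℤ) : ℝ)) ^ 2) =
      (L : ℝ) ^ 2 := by
    simp [hsq, hcard]
  rw [hB, abs_of_neg hU] at h
  have hgrad : ∀ x y : FermionTorus 2 L, (Gᴸ).Adj x y →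
      (((torusStagger (d := 2) (L := L) x : ℤ) : ℝ) - ((torusStagger (d := 2) (L := L) y : ℤ) : ℝ)) ^ 2
        = 4 := by
    intro x y hxy
    have e : ((torusStagger (d := 2) (L := L) y : ℤ) : ℝ) =
        -((torusStagger (d := 2) (L := L) x : ℤ) : ℝ) := by
      rw [hε x y hxy, Units.val_neg, Int.cast_neg, neg_neg]
    rw [e, show ∀ r : ℝ, (r - -r) ^ 2 = 4 * r ^ 2 from fun r => by ring, hsq x, mul_one]
  have hdc : (M_Q).toBlock p p *
        ((hamiltonianWith Gᴸ 1 U 0).toBlock p p * (M_Q).toBlock p p -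
          (M_Q).toBlock p p * (hamiltonianWith Gᴸ 1 U 0).toBlock p p) -
      ((hamiltonianWith Gᴸ 1 U 0).toBlock p p * (M_Q).toBlock p p -
          (M_Q).toBlock p p * (hamiltonianWith Gᴸ 1 U 0).toBlock p p) * (M_Q).toBlock p p =
      -((((4 : ℝ) : ℂ)) • (hubbardTorusTT' L 1 0 0).toBlock p p) := by
    rw [spinDensityField_doubleComm_toBlock_eq Gᴸ _ 1 U 0 p hp, hoppingForm_eq_smul_one_of_adj Gᴸ hgrad,
      hoppingForm_one_eq_neg_hubbardTorusTT', Complex.ofReal_one, one_smul, smul_neg]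
    rfl
  have hre : (gibbsState β ((hamiltonianWith Gᴸ 1 U 0).toBlock p p) ((M_Q).toBlock p p *
        ((hamiltonianWith Gᴸ 1 U 0).toBlock p p * (M_Q).toBlock p p -
          (M_Q).toBlock p p * (hamiltonianWith Gᴸ 1 U 0).toBlock p p) -
      ((hamiltonianWith Gᴸ 1 U 0).toBlock p p * (M_Q).toBlock p p -
          (M_Q).toBlock p p * (hamiltonianWith Gᴸ 1 U 0).toBlock p p) * (M_Q).toBlock p p)).re =
      4 * (-(gibbsState β ((hubbardTorusTT' L 1 0 U).toBlock p p)
        ((hubbardTorusTT' L 1 0 0).toBlock p p)).re) := by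
    rw [hdc, map_neg, map_smul, Complex.neg_re, smul_eq_mul, Complex.re_ofReal_mul,
      hubbardTorusTT'_eq_hamiltonianWith U]
    ring
  have h' : (gibbsState β ((hamiltonianWith Gᴸ 1 U 0).toBlock p p)
      ((M_Q).toBlock p p * (M_Q).toBlock p p)).re ≤
      (L : ℝ) ^ 2 / (-U) / β +
        1 / 2 * Real.sqrt ((L : ℝ) ^ 2 / (-U) *
          (gibbsState β ((hamiltonianWith Gᴸ 1 U 0).toBlock p p) ((M_Q).toBlock p p *
              ((hamiltonianWith Gᴸ 1 U 0).toBlock p p * (M_Q).toBlock p p -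
                (M_Q).toBlock p p * (hamiltonianWith Gᴸ 1 U 0).toBlock p p) -
            ((hamiltonianWith Gᴸ 1 U 0).toBlock p p * (M_Q).toBlock p p -
                (M_Q).toBlock p p * (hamiltonianWith Gᴸ 1 U 0).toBlock p p) * (M_Q).toBlock p p)).re) := by
    convert h using 12
  rw [hre] at h'
  rw [hubbardTorusTT'_eq_hamiltonianWith U]
  refine h'.trans (fbRhs_mono_doubleComm (div_nonneg (sq_nonneg _) hU0.le) ?_)
  exact mul_le_mul_of_nonneg_left hkin (by norm_num)

/-- **Cor. 11.2(ii), sharp form: the SDW ceiling of the attractive torus in a `(m ↑, m ↓)` sector,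
UNCONDITIONAL** (`L ≥ 4` even, `U < 0`, `β > 0`, `m ≤ L²`, `N_p = dim p = binom(L², m)²`):
`⟨(M_Q|_p)²⟩_{β,p} ≤ L²/(β|U|) + ½ √((L²/|U|) · 4 (32 L²/|U| + (log N_p)/β))` — the kinetic slot is
Thm 8♯(v) at `T > 0` (`neg_re_gibbsState_hopping_le_attractive_sharp`, #106). -/
theorem re_gibbsState_staggeredSpin_sq_toBlock_le_attractive_sharp (hLe : Even L) (hL : 3 ≤ L)
    {U β : ℝ} (hU : U < 0) (hβ : 0 < β) {m : ℕ} (hm : m ≤ L ^ 2)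
    (p : Finset (Orb (FermionTorus 2 L)) → Prop) [DecidablePred p] [Nonempty {s // p s}]
    (hp : ∀ s, p s ↔ (upPart s).card = m ∧ (downPart s).card = m) :
    (gibbsState β ((hubbardTorusTT' L 1 0 U).toBlock p p) ((M_Q).toBlock p p * (M_Q).toBlock p p)).re ≤
      (L : ℝ) ^ 2 / (-U) / β + 1 / 2 * Real.sqrt ((L : ℝ) ^ 2 / (-U) *
        (4 * (32 * (L : ℝ) ^ 2 / (-U) + Real.log (Fintype.card {s // p s}) / β))) := by
  have hpN : ∀ s, p s → s.card = 2 * m := fun s hs => by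
    rw [card_eq_upPart_add_downPart, ((hp s).1 hs).1, ((hp s).1 hs).2]; ring
  have hpair : ∀ A : Finset (FermionTorus 2 L), A.card = m → p (pairSet A A) := fun A hA =>
    (hp _).2 ((spinZeroSector_iff_upPart_downPart _ m).1 (pairSet_mem_spinZeroSector A hA))
  exact re_gibbsState_staggeredSpin_sq_toBlock_le_of_kinetic hLe hU hβ p hp
    (neg_re_gibbsState_hopping_le_attractive_sharp hLe hL hU hβ hm p hpN hpair)

/-- **Cor. 11.2(ii), density form** (`L` even, `U < 0`, `β > 0`, `m ≤ L²`):
`⟨(M_Q|_p)²⟩_{β,p} ≤ L²/(β|U|) + ½ √((L²/|U|) · 4 (256 m/|U| + (log N_p)/β))` — the kinetic slot is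
Thm 9(v) at `T > 0` (`neg_re_gibbsState_hopping_le_attractive_density`, #103; proportional to the
pair number `m`, better than the sharp form for `n = 2m/L² < 1/4`). -/
theorem re_gibbsState_staggeredSpin_sq_toBlock_le_attractive_density (hLe : Even L)
    {U β : ℝ} (hU : U < 0) (hβ : 0 < β) {m : ℕ} (hm : m ≤ L ^ 2)
    (p : Finset (Orb (FermionTorus 2 L)) → Prop) [DecidablePred p] [Nonempty {s // p s}]
    (hp : ∀ s, p s ↔ (upPart s).card = m ∧ (downPart s).card = m) :
    (gibbsState β ((hubbardTorusTT' L 1 0 U).toBlock p p) ((M_Q).toBlock p p * (M_Q).toBlock p p)).re ≤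
      (L : ℝ) ^ 2 / (-U) / β + 1 / 2 * Real.sqrt ((L : ℝ) ^ 2 / (-U) *
        (4 * (256 * (m : ℝ) / (-U) + Real.log (Fintype.card {s // p s}) / β))) := by
  have hpN : ∀ s, p s → s.card = 2 * m := fun s hs => by
    rw [card_eq_upPart_add_downPart, ((hp s).1 hs).1, ((hp s).1 hs).2]; ring
  have hpair : ∀ A : Finset (FermionTorus 2 L), A.card = m → p (pairSet A A) := fun A hA =>
    (hp _).2 ((spinZeroSector_iff_upPart_downPart _ m).1 (pairSet_mem_spinZeroSector A hA))
  have hkin : -(gibbsState β ((hubbardTorusTT' L 1 0 U).toBlock p p)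
      ((hubbardTorusTT' L 1 0 0).toBlock p p)).re ≤
      256 * (m : ℝ) / (-U) + Real.log (Fintype.card {s // p s}) / β := by
    have h := neg_re_gibbsState_hopping_le_attractive_density 0 hU hβ hm p hpN hpair
    simpa only [abs_zero, add_zero, one_pow, mul_one] using h
  exact re_gibbsState_staggeredSpin_sq_toBlock_le_of_kinetic hLe hU hβ p hp hkin

/-- Node form of the sharp SDW ceiling (UNCONDITIONAL; the sector and state of
`ThermalAttractiveKineticCeilingSharp`, #106). Per site, with `N_p = binom(L², m)²` (`log N_p ≤ L² log 4`):
`4 S^{zz}(Q)_p := ⟨(M_Q|_p)²⟩_{β,p}/L² ≤ T/|U| + √(κ̃_p/|U|)`, `κ̃_p = 32/|U| + T (log N_p)/L² ≤ 32/|U|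
+ T log 4`, every even `L ≥ 4`, every density `n = 2m/L²`, every `T > 0`. kind: support (PROVED).
Why it might fail: it cannot; informative (below the degree form `T/|U| + √(4/|U|)`) only for
`|U| > 8 t`. Sources: KuboKishi1990 Thm 1, Remark 3; LiebPRL1989 Thm 1; DLS1978 Lemma 4.1, Thm 3.1;
MicnasRanningerRobaszkiewicz1990 §IV; this cell (bounds.tex Thm 8♯(v), Thm 11, Cor. 11.2(ii)). -/
@[conjecture] def ThermalAttractiveSDWCeilingCanonical : Prop :=
  ∀ (L : ℕ) [NeZero L], Even L → 3 ≤ L → ∀ (U β : ℝ) (m : ℕ), U < 0 → 0 < β → m ≤ L ^ 2 →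
    let p : Finset (Orb (FermionTorus 2 L)) → Prop := fun s =>
      s.card = 2 * m ∧ 2 * (s.filter fun i => (ofLex i).2 = 0).card = 2 * m
    (gibbsState β ((hubbardTorusTT' L 1 0 U).toBlock p p)
        ((spinDensityField fun x => ((torusStagger (d := 2) (L := L) x : ℤ) : ℝ)).toBlock p p *
          (spinDensityField fun x => ((torusStagger (d := 2) (L := L) x : ℤ) : ℝ)).toBlock p p)).re ≤
      (L : ℝ) ^ 2 / (-U) / β + 1 / 2 * Real.sqrt ((L : ℝ) ^ 2 / (-U) *
        (4 * (32 * (L : ℝ) ^ 2 / (-U) + Real.log (Fintype.card {s // p s}) / β)))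

/-- **`ThermalAttractiveSDWCeilingCanonical` holds.** -/
theorem thermalAttractiveSDWCeilingCanonical_holds : ThermalAttractiveSDWCeilingCanonical := by
  intro L _ hLe hL U β m hU hβ hm
  dsimp only
  set p : Finset (Orb (FermionTorus 2 L)) → Prop := fun s =>
    s.card = 2 * m ∧ 2 * (s.filter fun i => (ofLex i).2 = 0).card = 2 * m with hp
  haveI : Nonempty {s // p s} := nonempty_spinZeroSector (L := L) hm
  exact re_gibbsState_staggeredSpin_sq_toBlock_le_attractive_sharp hLe hL hU hβ hm p
    fun s => spinZeroSector_iff_upPart_downPart s m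

/-- Node form of the density SDW ceiling (UNCONDITIONAL): per site, `n = 2m/L²`, `4 S^{zz}(Q)_p ≤
T/|U| + √((128 n/|U| + T (log N_p)/L²)/|U|)`, every even `L`, `m ≤ L²`, `T > 0`. kind: support (PROVED).
Sources: KuboKishi1990 Thm 1, Remark 3; DLS1978 Thm 3.1; this cell (bounds.tex Thm 9(v), Cor. 11.2(ii)). -/
@[conjecture] def ThermalAttractiveSDWCeilingCanonicalDensity : Prop :=
  ∀ (L : ℕ) [NeZero L], Even L → ∀ (U β : ℝ) (m : ℕ), U < 0 → 0 < β → m ≤ L ^ 2 →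
    let p : Finset (Orb (FermionTorus 2 L)) → Prop := fun s =>
      s.card = 2 * m ∧ 2 * (s.filter fun i => (ofLex i).2 = 0).card = 2 * m
    (gibbsState β ((hubbardTorusTT' L 1 0 U).toBlock p p)
        ((spinDensityField fun x => ((torusStagger (d := 2) (L := L) x : ℤ) : ℝ)).toBlock p p *
          (spinDensityField fun x => ((torusStagger (d := 2) (L := L) x : ℤ) : ℝ)).toBlock p p)).re ≤
      (L : ℝ) ^ 2 / (-U) / β + 1 / 2 * Real.sqrt ((L : ℝ) ^ 2 / (-U) *
        (4 * (256 * (m : ℝ) / (-U) + Real.log (Fintype.card {s // p s}) / β)))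

/-- **`ThermalAttractiveSDWCeilingCanonicalDensity` holds.** -/
theorem thermalAttractiveSDWCeilingCanonicalDensity_holds :
    ThermalAttractiveSDWCeilingCanonicalDensity := by
  intro L _ hLe U β m hU hβ hm
  dsimp only
  set p : Finset (Orb (FermionTorus 2 L)) → Prop := fun s =>
    s.card = 2 * m ∧ 2 * (s.filter fun i => (ofLex i).2 = 0).card = 2 * m with hp
  haveI : Nonempty {s // p s} := nonempty_spinZeroSector (L := L) hm
  exact re_gibbsState_staggeredSpin_sq_toBlock_le_attractive_density hLe hU hβ hm p
    fun s => spinZeroSector_iff_upPart_downPart s m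

/-! ### The instance `U = -20 t` -/

/-- **`U = -20 t`: `4 S^{zz}(Q)_p ≤ T/20 + √((1.6 + T log 4)/20)`** per site in every canonical
`(2m, S^z = 0)` ensemble of the attractive torus, every even `L ≥ 4`, every density, every
`T = 1/β > 0`, UNCONDITIONAL (`= 0.283` at `T → 0` against `0.447` from the degree bound of KK90
Remark 3). kind: support (PROVED). -/
@[conjecture] def ThermalAttractiveSDWCeilingCanonicalU20 : Prop :=
  ∀ (L : ℕ) [NeZero L], Even L → 3 ≤ L → ∀ (β : ℝ) (m : ℕ), 0 < β → m ≤ L ^ 2 →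
    let p : Finset (Orb (FermionTorus 2 L)) → Prop := fun s =>
      s.card = 2 * m ∧ 2 * (s.filter fun i => (ofLex i).2 = 0).card = 2 * m
    (gibbsState β ((hubbardTorusTT' L 1 0 (-20)).toBlock p p)
        ((spinDensityField fun x => ((torusStagger (d := 2) (L := L) x : ℤ) : ℝ)).toBlock p p *
          (spinDensityField fun x => ((torusStagger (d := 2) (L := L) x : ℤ) : ℝ)).toBlock p p)).re ≤
      (L : ℝ) ^ 2 * (1 / (20 * β) + Real.sqrt ((1.6 + Real.log 4 / β) / 20))

/-- **`ThermalAttractiveSDWCeilingCanonicalU20` holds.** -/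
theorem thermalAttractiveSDWCeilingCanonicalU20_holds : ThermalAttractiveSDWCeilingCanonicalU20 := by
  intro L _ hLe hL β m hβ hm
  dsimp only
  set p : Finset (Orb (FermionTorus 2 L)) → Prop := fun s =>
    s.card = 2 * m ∧ 2 * (s.filter fun i => (ofLex i).2 = 0).card = 2 * m with hp
  haveI : Nonempty {s // p s} := nonempty_spinZeroSector (L := L) hm
  have h := re_gibbsState_staggeredSpin_sq_toBlock_le_attractive_sharp hLe hL (U := -20)
    (by norm_num) hβ hm p fun s => spinZeroSector_iff_upPart_downPart s m
  simp only [neg_neg] at h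
  have hL2 : (0 : ℝ) < (L : ℝ) ^ 2 := by
    have : (0 : ℝ) < L := by exact_mod_cast (show 0 < L by omega)
    positivity
  set ℓ : ℝ := Real.log (Fintype.card {s // p s}) with hℓ
  have hℓle : ℓ / β ≤ (L : ℝ) ^ 2 * (Real.log 4 / β) := by
    rw [mul_div_assoc']
    exact div_le_div_of_nonneg_right (log_card_sector_le_log_four p) hβ.le
  have e16 : (1.6 : ℝ) = 32 / 20 := by norm_num
  have e1 : (L : ℝ) ^ 2 / 20 * (4 * (32 * (L : ℝ) ^ 2 / 20 + ℓ / β)) =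
      (2 * (L : ℝ) ^ 2) ^ 2 * ((32 / 20 + (ℓ / β) / (L : ℝ) ^ 2) / 20) := by
    field_simp
    ring
  have hsqrt : Real.sqrt ((L : ℝ) ^ 2 / 20 * (4 * (32 * (L : ℝ) ^ 2 / 20 + ℓ / β))) ≤
      2 * (L : ℝ) ^ 2 * Real.sqrt ((1.6 + Real.log 4 / β) / 20) := by
    rw [e1, e16, Real.sqrt_mul (sq_nonneg _), Real.sqrt_sq (by positivity)]
    refine mul_le_mul_of_nonneg_left (Real.sqrt_le_sqrt ?_) (by positivity)
    have hq : ℓ / β / (L : ℝ) ^ 2 ≤ Real.log 4 / β := by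
      rw [div_le_iff₀ hL2, mul_comm]
      exact hℓle
    exact div_le_div_of_nonneg_right (add_le_add le_rfl hq) (by norm_num)
  have e2 : (L : ℝ) ^ 2 * (1 / (20 * β) + Real.sqrt ((1.6 + Real.log 4 / β) / 20)) =
      (L : ℝ) ^ 2 / 20 / β +
        1 / 2 * (2 * (L : ℝ) ^ 2 * Real.sqrt ((1.6 + Real.log 4 / β) / 20)) := by
    ring
  rw [e2]
  linarith

end Torus

end Summit.HubbardSuperconductivity.HubbardLadder.Bounds

end
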